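import Summits.QuantumFields.YangMills.Theorems.FluctuationComparisonRegPrIntLBeyondOneLoopInteriorGasDoor
import HarnessLib

/-!
# THE INTERIOR PRODUCT-FORMULA DOOR FOR ROW 2 OF THE S2β TABLE: a λ-uniform exponentiated cluster expansion in PRODUCT FORM on the INTERIOR window ⟨ECE∘⟩ GIVES the
# REGISTERED interior row H4ᶜ∘ `BeyondOneLoopSmallIntCan` VERBATIM with NO other organ — the interior edition of px20's ✓p783037 door (the edition an interior hand can prove)

Cell `ym3-torus` (YM ladder rung R3 = continuum `SU(2)` Yang–Mills on the three-torus — a RUNG, NOT d = 4, NOT infinite volume, NOT a mass gap, NOT Clay).  Seat `ymfull-r3-prover-2`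
(gen 0; R600-ym: hand = the REGISTERED stub `stub_beyondOneLoopSmallIntCan : BeyondOneLoopSmallIntCan`, registry `Cruxes/FluctuationComparisonRegPrIntL/Lines/semiclassical_s2beta.lean`
v11.4 `def` l.571 ∕ stub l.1580; PLAN `Lines/loop_ledger.lean` v6); `--supports stmt-QuantumFields-20520 --as helper`, count-neutral, definition-free, default heartbeats; no registry,
binder or `Lines/` edit (RULING №36 untouched).  Sixth of a chain (✓p786380 InteriorDoor, ✓p787654 InteriorGasDoor, ✓p787786 KP letter №1, ✓p789479 InteriorGeometricDoor, ✓p789670 MultiGasDoor).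

WHY THIS EDITION.  ✓p787654 `beyondOneLoopSmallInt_of_productFormula` consumes px20's FULL-WINDOW letter ⟨ECE⟩ (product formula asserted on `{PlaqSmall (θBal F.L γ b₀ p₀ J)}`).  After R3-FLIN
(★★OWNER WORD 80∕81∕87: on the full window the one-step constrained minimiser over an edge datum may leave `histGood_{J+1}` at `L = 3, 5`) every provable row of the registry reads
its window clauses on the `cw`-INTERIOR `{PlaqSmall (θBal F.L γ (cw * b₀) p₀ J)}` while the history keeps the profile `b₀`; a hand working where EXW∘ ∕ GAP♯∘ hold will therefore
prove the product formula ON THE INTERIOR WINDOW ONLY — the letter ⟨ECE∘⟩ := ⟨ECE⟩ with the registry's two ∘-moves (fraction prefix `∃ c₀, 0 < c₀ ∧ c₀ ≤ 1 ∧ ∀ cw, 0 < cw → cw ≤ c₀ →`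
after `∀ L`; the four window clauses — positivity of `ell`, domination of `w 1`, positivity + product formula for `λ ≥ 1`, `log Ξ(w^λ) → 0` — at `cw * b₀`; history `b₀`).  THIS FILE:
* ★ `sclInt_of_productFormulaInt : ⟨ECE∘⟩ → ⟨SCL∘⟩` — the split `f^λ U = log C_λ + log ℓ U + log Ξ(w^λ_U)` on the interior window (px20's ✓`log_add_eq_of_mul_exp_eq`) and
  ✓`tendsto_sub_of_split`; the trivial field is an INTERIOR datum (`θBal F.L γ (cw*b₀) p₀ J = cw·θBal(b₀) > 0`, lit ✓`θBal_mul`, ✓`θBal_pos`, ✓`plaqSmall_one`; `γ₁ ↦ min γ₁ 1`).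
* ★ `gasInt_of_productFormulaInt : ⟨ECE∘⟩ → ⟨GAS∘⟩` — per depth px20's ✓`eq_const_add_limUnder_add_of_split` (`F₀ U = log ℓ U − log ℓ 𝟙`, `c := log C₁ + log ℓ 𝟙`, `w := w 1`).
* ★ `productFormulaInt_of_productFormula : ⟨ECE⟩ → ⟨ECE∘⟩` (`c₀ := 1`; interior ⊆ full by lit ✓`θBal_mul_le` + ✓`plaqSmall_of_le`) — so the full-window letter still serves.
* ★★★ `beyondOneLoopSmallInt_of_productFormulaInt : ⟨ECE∘⟩ → ⟨BeyondOneLoopSmallIntCan VERBATIM⟩` (✓p787654 `beyondOneLoopSmallInt_of_gasInt` after the two ★).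
Door-fit (HOME cert `ymfull-r3-prover-2/g0/DOORFIT-BeyondOneLoopInteriorProductDoor.cert.lean`): `example (h : ⟨ECE∘⟩) : BeyondOneLoopSmallIntCan := beyondOneLoopSmallInt_of_productFormulaInt h`
against the pasted registry v11.4 ∕ loop_ledger v6 texts (⟨ECE∘⟩ phrased with the pasted `heightDensityCan`, `gasZ`, `KPGasOn` names).

HONEST SCOPE.  Filter ∕ logarithm algebra and quantifier plumbing; ⟨ECE∘⟩ is a HYPOTHESIS — the one-step ∕ multi-step small-field cluster expansion of [Balaban1987RG1] Thm 1 ∕ [Balaban1988Convergent]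
read in d = 3 in product form on the interior window (XL, nobody's theorem); nothing of Bałaban's is asserted or proved; `BeyondOneLoopSmallIntCan`, the other four registered ∘-stubs, S2β and
`FluctuationComparisonRegPrIntL` (stmt-QuantumFields-20520) are NOT proved; no summit statement is proved by a helper; rung R3 = SU(2) YM₃ on T³ — finite volume, conditional; NOT d = 4, NOT
infinite volume, NOT a mass gap, NOT Clay; the Yang–Mills mass gap is NOT proved.

References: T. Bałaban, CMP **109** (1987) 249–301 [Balaban1987RG1] (Thm 1, (0.17)–(0.26) pp.255–257); CMP **102** (1985) 255–275 [Balaban1985UV3] ((7) p.257, (35) p.265, (45)–(47) p.267);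
CMP **119** (1988) 243–285 [Balaban1988Convergent] (Thm 1); CMP **122** (1989) 355–392 [Balaban1989LargeFieldII] ((1.90) p.388, (1.97)–(1.100) pp.389–390).
-/

noncomputable section

open MeasureTheory Filter Topology Set
open Literature.Probability.LatticeModels (polymerPartitionFunction polyInc)
open Literature.MathematicalPhysics.QuantumFieldTheory.Balaban1983to89
open Literature.MathematicalPhysics.QuantumFieldTheory.Balaban1983to89.T3ContinuumYM3Torus
open Literature.MathematicalPhysics.QuantumFieldTheory.Balaban1983to89.T3NestedUnitLaws
open Literature.MathematicalPhysics.QuantumFieldTheory.Balaban1983to89.T3UnitLawDensityEML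
open Literature.MathematicalPhysics.QuantumFieldTheory.Balaban1983to89.T3UnitScaleTilt
open Literature.MathematicalPhysics.QuantumFieldTheory.Balaban1983to89.T3TiltDescent
open Literature.MathematicalPhysics.QuantumFieldTheory.Balaban1983to89.T3PrintedRegularMinimiser
open Summit.QuantumFields.YangMills.Theorems.BeyondOneLoopInteriorDoor
open Summit.QuantumFields.YangMills.Theorems.BeyondOneLoopInteriorGasDoor
open Summit.QuantumFields.YangMills.Theorems.LoopLedgerGasOfProductFormula

namespace Summit.QuantumFields.YangMills.Theorems.BeyondOneLoopInteriorProductDoor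

open Classical in
/-- ★ **⟨ECE∘⟩ → ⟨SCL∘⟩**: on the interior window the product formula splits `f^λ U = log C_λ + log ℓ U + log Ξ(w^λ_U)`, so `f^λ U − f^λ 𝟙 → log ℓ U − log ℓ 𝟙`; the trivial field is an
interior datum because `θBal F.L γ (cw * b₀) p₀ J = cw · θBal F.L γ b₀ p₀ J > 0` (`γ ≤ 1` folded into `γ₁`). [cite: Balaban1987RG1, (0.17)-(0.22) pp.255-256; Balaban1985UV3, (7) p.257] -/
theorem sclInt_of_productFormulaInt
    (hE : ∀ (L : ℕ), ∃ c₀ : ℝ, 0 < c₀ ∧ c₀ ≤ 1 ∧ ∀ (cw : ℝ), 0 < cw → cw ≤ c₀ →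
      ∃ pS : ℝ, ∀ (b₀ p₀ : ℝ), 0 < b₀ → pS ≤ p₀ → 0 < p₀ → ∃ ε₁ : ℝ, 0 < ε₁ ∧ ∀ (ε₀ : ℝ), 0 < ε₀ → ε₀ ≤ ε₁ →
      ∃ γ₁ : ℝ, 0 < γ₁ ∧ ∃ κ : ℝ, 0 < κ ∧
        ∀ (F : T3Family) (γ : ℝ), F.L = L → 0 < γ → γ ≤ γ₁ →
          ∃ Φ : ℕ → ℝ, (∀ J, 0 ≤ Φ J) ∧ Tendsto (fun J : ℕ => (J : ℝ) * Φ J) atTop (𝓝 0) ∧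
            ∀ (J K : ℕ) (hJK : J ≤ K),
              ∃ (Cl : ℝ → ℝ) (ell : GaugeField (F.P J) 0 (Matrix.specialUnitaryGroup (Fin 2) ℂ) → ℝ)
                (w : ℝ → GaugeField (F.P J) 0 (Matrix.specialUnitaryGroup (Fin 2) ℂ) → Finset (PBond (F.P J) 0) → ℝ),
              (∀ lam : ℝ, 1 ≤ lam → 0 < Cl lam) ∧
              (∀ U : GaugeField (F.P J) 0 (Matrix.specialUnitaryGroup (Fin 2) ℂ), PlaqSmall (θBal F.L γ (cw * b₀) p₀ J) U → 0 < ell U) ∧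
              (∃ (wbar a ℓ : Finset (PBond (F.P J) 0) → ℝ),
                (∀ U, w 1 U ∅ = 0) ∧
                (∀ (X : Finset (PBond (F.P J) 0)) (U U' : GaugeField (F.P J) 0 (Matrix.specialUnitaryGroup (Fin 2) ℂ)),
                  (∀ e ∈ X, U e = U' e) → w 1 U X = w 1 U' X) ∧
                (∀ X, 0 ≤ a X) ∧ (∀ X, 0 ≤ ℓ X) ∧
                (∀ U, U ∈ {U : GaugeField (F.P J) 0 (Matrix.specialUnitaryGroup (Fin 2) ℂ) | PlaqSmall (θBal F.L γ (cw * b₀) p₀ J) U} → ∀ X, |w 1 U X| ≤ wbar X) ∧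
                (∀ X : Finset (PBond (F.P J) 0), ∀ e ∈ X, ∀ e' ∈ X, (e.src.tdist e'.src : ℝ) ≤ ℓ X) ∧
                (∀ X : Finset (PBond (F.P J) 0), ∑ X' ∈ Finset.univ.filter (fun X' => polyInc X' X),
                    wbar X' * Real.exp (a X' + κ * ℓ X') ≤ a X) ∧
                (∀ e : PBond (F.P J) 0, a {e} ≤ (Φ J))) ∧
              (∀ lam : ℝ, 1 ≤ lam → ∀ U : GaugeField (F.P J) 0 (Matrix.specialUnitaryGroup (Fin 2) ℂ), PlaqSmall (θBal F.L γ (cw * b₀) p₀ J) U →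
                0 < (polymerPartitionFunction polyInc (fun X : Finset (PBond (F.P J) 0) => ((w lam U X : ℝ) : ℂ)) Finset.univ).re ∧
                Node00.canonVersion (fieldMeasure (F.P J) 0 (Matrix.specialUnitaryGroup (Fin 2) ℂ))
                    (heightDensity F (γ / lam) hJK (histGood F ℰp (θBal F.L γ b₀ p₀) K J)) U
                  * Real.exp ((F.scheme ℰp (γ / lam)).β K * minActionRegPr F J K hJK ε₀ U)
                = Cl lam * ell U * (polymerPartitionFunction polyInc (fun X : Finset (PBond (F.P J) 0) => ((w lam U X : ℝ) : ℂ)) Finset.univ).re) ∧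
              (∀ U : GaugeField (F.P J) 0 (Matrix.specialUnitaryGroup (Fin 2) ℂ), PlaqSmall (θBal F.L γ (cw * b₀) p₀ J) U →
                Tendsto (fun lam : ℝ => Real.log (polymerPartitionFunction polyInc (fun X : Finset (PBond (F.P J) 0) => ((w lam U X : ℝ) : ℂ)) Finset.univ).re) atTop (𝓝 0))) :
    ∀ (L : ℕ), ∃ c₀ : ℝ, 0 < c₀ ∧ c₀ ≤ 1 ∧ ∀ (cw : ℝ), 0 < cw → cw ≤ c₀ →
      ∃ pS : ℝ, ∀ (b₀ p₀ : ℝ), 0 < b₀ → pS ≤ p₀ → 0 < p₀ → ∃ ε₁ : ℝ, 0 < ε₁ ∧ ∀ (ε₀ : ℝ), 0 < ε₀ → ε₀ ≤ ε₁ →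
      ∃ γ₁ : ℝ, 0 < γ₁ ∧ ∀ (F : T3Family) (γ : ℝ), F.L = L → 0 < γ → γ ≤ γ₁ →
        ∀ (J K : ℕ) (hJK : J ≤ K) (V : GaugeField (F.P J) 0 (Matrix.specialUnitaryGroup (Fin 2) ℂ)), PlaqSmall (θBal F.L γ (cw * b₀) p₀ J) V →
          ∃ a : ℝ, Tendsto (fun lam : ℝ =>
            (Real.log (Node00.canonVersion (fieldMeasure (F.P J) 0 (Matrix.specialUnitaryGroup (Fin 2) ℂ)) (heightDensity F (γ / lam) hJK (histGood F ℰp (θBal F.L γ b₀ p₀) K J)) V) + (F.scheme ℰp (γ / lam)).β K * minActionRegPr F J K hJK ε₀ V)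
            - (Real.log (Node00.canonVersion (fieldMeasure (F.P J) 0 (Matrix.specialUnitaryGroup (Fin 2) ℂ)) (heightDensity F (γ / lam) hJK (histGood F ℰp (θBal F.L γ b₀ p₀) K J)) 1) + (F.scheme ℰp (γ / lam)).β K * minActionRegPr F J K hJK ε₀ 1)) atTop (𝓝 a) := by
  intro L
  obtain ⟨c₀, hc₀, hc₀1, H⟩ := hE L
  refine ⟨c₀, hc₀, hc₀1, fun cw hcw hcwle => ?_⟩
  obtain ⟨pS, H0⟩ := H cw hcw hcwle
  refine ⟨pS, fun b₀ p₀ hb hp hp0 => ?_⟩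
  obtain ⟨ε₁, hε₁, H1⟩ := H0 b₀ p₀ hb hp hp0
  refine ⟨ε₁, hε₁, fun ε₀ hε₀ hε₀le => ?_⟩
  obtain ⟨γ₁, hγ₁, κ, -, H2⟩ := H1 ε₀ hε₀ hε₀le
  refine ⟨min γ₁ 1, lt_min hγ₁ one_pos, fun F γ hFL hγ hγle J K hJK V hV => ?_⟩
  obtain ⟨Φ, -, -, H3⟩ := H2 F γ hFL hγ (hγle.trans (min_le_left _ _))
  obtain ⟨Cl, ell, w, hCl, hell, -, hprodZ, hlim⟩ := H3 J K hJK
  have hθ : 0 < θBal F.L γ (cw * b₀) p₀ J := by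
    rw [T3InteriorExcision.θBal_mul]
    exact mul_pos hcw (T3MinimiserStabilityReduction.θBal_pos (le_of_lt F.hL.2) hγ (hγle.trans (min_le_right _ _)) hb p₀ J)
  have h1 : PlaqSmall (θBal F.L γ (cw * b₀) p₀ J) (1 : GaugeField (F.P J) 0 (Matrix.specialUnitaryGroup (Fin 2) ℂ)) := T3DescentFibreTower.plaqSmall_one hθ
  have hsplit : ∀ lam : ℝ, 1 ≤ lam → ∀ U, U ∈ {U : GaugeField (F.P J) 0 (Matrix.specialUnitaryGroup (Fin 2) ℂ) | PlaqSmall (θBal F.L γ (cw * b₀) p₀ J) U} →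
      (fun (lam : ℝ) (U : GaugeField (F.P J) 0 (Matrix.specialUnitaryGroup (Fin 2) ℂ)) => (Real.log (Node00.canonVersion (fieldMeasure (F.P J) 0 (Matrix.specialUnitaryGroup (Fin 2) ℂ)) (heightDensity F (γ / lam) hJK (histGood F ℰp (θBal F.L γ b₀ p₀) K J)) U) + (F.scheme ℰp (γ / lam)).β K * minActionRegPr F J K hJK ε₀ U)) lam U
        = (fun lam : ℝ => Real.log (Cl lam)) lam + (fun U => Real.log (ell U)) U
          + (fun (lam : ℝ) (U : GaugeField (F.P J) 0 (Matrix.specialUnitaryGroup (Fin 2) ℂ)) =>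
              Real.log ((polymerPartitionFunction polyInc (fun X : Finset (PBond (F.P J) 0) => ((w lam U X : ℝ) : ℂ)) Finset.univ).re)) lam U :=
    fun lam hlam U hU => log_add_eq_of_mul_exp_eq (hCl lam hlam) (hell U hU) (hprodZ lam hlam U hU).1 (hprodZ lam hlam U hU).2
  exact ⟨Real.log (ell V) - Real.log (ell 1), tendsto_sub_of_split hsplit (fun U hU => hlim U hU) hV h1⟩

open Classical in
/-- ★ **⟨ECE∘⟩ → ⟨GAS∘⟩**: per depth `F₀ U = log ℓ U − log ℓ 𝟙` (`Tendsto.limUnder_eq`), and at `λ = 1`, `f¹ U = (log C₁ + log ℓ 𝟙) + F₀ U + log Ξ(w¹_U)` on the interior window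
(px20's ✓`eq_const_add_limUnder_add_of_split`); the KP data of `w 1` pass through. [cite: Balaban1987RG1, (0.17)-(0.26) pp.255-257; Balaban1989LargeFieldII, (1.90) p.388] -/
theorem gasInt_of_productFormulaInt
    (hE : ∀ (L : ℕ), ∃ c₀ : ℝ, 0 < c₀ ∧ c₀ ≤ 1 ∧ ∀ (cw : ℝ), 0 < cw → cw ≤ c₀ →
      ∃ pS : ℝ, ∀ (b₀ p₀ : ℝ), 0 < b₀ → pS ≤ p₀ → 0 < p₀ → ∃ ε₁ : ℝ, 0 < ε₁ ∧ ∀ (ε₀ : ℝ), 0 < ε₀ → ε₀ ≤ ε₁ →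
      ∃ γ₁ : ℝ, 0 < γ₁ ∧ ∃ κ : ℝ, 0 < κ ∧
        ∀ (F : T3Family) (γ : ℝ), F.L = L → 0 < γ → γ ≤ γ₁ →
          ∃ Φ : ℕ → ℝ, (∀ J, 0 ≤ Φ J) ∧ Tendsto (fun J : ℕ => (J : ℝ) * Φ J) atTop (𝓝 0) ∧
            ∀ (J K : ℕ) (hJK : J ≤ K),
              ∃ (Cl : ℝ → ℝ) (ell : GaugeField (F.P J) 0 (Matrix.specialUnitaryGroup (Fin 2) ℂ) → ℝ)
                (w : ℝ → GaugeField (F.P J) 0 (Matrix.specialUnitaryGroup (Fin 2) ℂ) → Finset (PBond (F.P J) 0) → ℝ),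
              (∀ lam : ℝ, 1 ≤ lam → 0 < Cl lam) ∧
              (∀ U : GaugeField (F.P J) 0 (Matrix.specialUnitaryGroup (Fin 2) ℂ), PlaqSmall (θBal F.L γ (cw * b₀) p₀ J) U → 0 < ell U) ∧
              (∃ (wbar a ℓ : Finset (PBond (F.P J) 0) → ℝ),
                (∀ U, w 1 U ∅ = 0) ∧
                (∀ (X : Finset (PBond (F.P J) 0)) (U U' : GaugeField (F.P J) 0 (Matrix.specialUnitaryGroup (Fin 2) ℂ)),
                  (∀ e ∈ X, U e = U' e) → w 1 U X = w 1 U' X) ∧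
                (∀ X, 0 ≤ a X) ∧ (∀ X, 0 ≤ ℓ X) ∧
                (∀ U, U ∈ {U : GaugeField (F.P J) 0 (Matrix.specialUnitaryGroup (Fin 2) ℂ) | PlaqSmall (θBal F.L γ (cw * b₀) p₀ J) U} → ∀ X, |w 1 U X| ≤ wbar X) ∧
                (∀ X : Finset (PBond (F.P J) 0), ∀ e ∈ X, ∀ e' ∈ X, (e.src.tdist e'.src : ℝ) ≤ ℓ X) ∧
                (∀ X : Finset (PBond (F.P J) 0), ∑ X' ∈ Finset.univ.filter (fun X' => polyInc X' X),
                    wbar X' * Real.exp (a X' + κ * ℓ X') ≤ a X) ∧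
                (∀ e : PBond (F.P J) 0, a {e} ≤ (Φ J))) ∧
              (∀ lam : ℝ, 1 ≤ lam → ∀ U : GaugeField (F.P J) 0 (Matrix.specialUnitaryGroup (Fin 2) ℂ), PlaqSmall (θBal F.L γ (cw * b₀) p₀ J) U →
                0 < (polymerPartitionFunction polyInc (fun X : Finset (PBond (F.P J) 0) => ((w lam U X : ℝ) : ℂ)) Finset.univ).re ∧
                Node00.canonVersion (fieldMeasure (F.P J) 0 (Matrix.specialUnitaryGroup (Fin 2) ℂ))
                    (heightDensity F (γ / lam) hJK (histGood F ℰp (θBal F.L γ b₀ p₀) K J)) U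
                  * Real.exp ((F.scheme ℰp (γ / lam)).β K * minActionRegPr F J K hJK ε₀ U)
                = Cl lam * ell U * (polymerPartitionFunction polyInc (fun X : Finset (PBond (F.P J) 0) => ((w lam U X : ℝ) : ℂ)) Finset.univ).re) ∧
              (∀ U : GaugeField (F.P J) 0 (Matrix.specialUnitaryGroup (Fin 2) ℂ), PlaqSmall (θBal F.L γ (cw * b₀) p₀ J) U →
                Tendsto (fun lam : ℝ => Real.log (polymerPartitionFunction polyInc (fun X : Finset (PBond (F.P J) 0) => ((w lam U X : ℝ) : ℂ)) Finset.univ).re) atTop (𝓝 0))) :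
    ∀ (L : ℕ), ∃ c₀ : ℝ, 0 < c₀ ∧ c₀ ≤ 1 ∧ ∀ (cw : ℝ), 0 < cw → cw ≤ c₀ →
      ∃ pS : ℝ, ∀ (b₀ p₀ : ℝ), 0 < b₀ → pS ≤ p₀ → 0 < p₀ → ∃ ε₁ : ℝ, 0 < ε₁ ∧ ∀ (ε₀ : ℝ), 0 < ε₀ → ε₀ ≤ ε₁ →
      ∃ γ₁ : ℝ, 0 < γ₁ ∧ ∃ κ : ℝ, 0 < κ ∧
        ∀ (F : T3Family) (γ : ℝ), F.L = L → 0 < γ → γ ≤ γ₁ →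
          ∃ Φ : ℕ → ℝ, (∀ J, 0 ≤ Φ J) ∧ Tendsto (fun J : ℕ => (J : ℝ) * Φ J) atTop (𝓝 0) ∧
            ∀ (J K : ℕ) (hJK : J ≤ K),
              ∃ (c : ℝ) (w : GaugeField (F.P J) 0 (Matrix.specialUnitaryGroup (Fin 2) ℂ) → Finset (PBond (F.P J) 0) → ℝ),
                (∃ (wbar a ℓ : Finset (PBond (F.P J) 0) → ℝ),
                (∀ U, w U ∅ = 0) ∧
                (∀ (X : Finset (PBond (F.P J) 0)) (U U' : GaugeField (F.P J) 0 (Matrix.specialUnitaryGroup (Fin 2) ℂ)),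
                  (∀ e ∈ X, U e = U' e) → w U X = w U' X) ∧
                (∀ X, 0 ≤ a X) ∧ (∀ X, 0 ≤ ℓ X) ∧
                (∀ U, U ∈ {U : GaugeField (F.P J) 0 (Matrix.specialUnitaryGroup (Fin 2) ℂ) | PlaqSmall (θBal F.L γ (cw * b₀) p₀ J) U} → ∀ X, |w U X| ≤ wbar X) ∧
                (∀ X : Finset (PBond (F.P J) 0), ∀ e ∈ X, ∀ e' ∈ X, (e.src.tdist e'.src : ℝ) ≤ ℓ X) ∧
                (∀ X : Finset (PBond (F.P J) 0), ∑ X' ∈ Finset.univ.filter (fun X' => polyInc X' X),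
                    wbar X' * Real.exp (a X' + κ * ℓ X') ≤ a X) ∧
                (∀ e : PBond (F.P J) 0, a {e} ≤ (Φ J))) ∧
                ∀ U : GaugeField (F.P J) 0 (Matrix.specialUnitaryGroup (Fin 2) ℂ), PlaqSmall (θBal F.L γ (cw * b₀) p₀ J) U →
                  (Real.log (Node00.canonVersion (fieldMeasure (F.P J) 0 (Matrix.specialUnitaryGroup (Fin 2) ℂ))
                      (heightDensity F (γ / 1) hJK (histGood F ℰp (θBal F.L γ b₀ p₀) K J)) U)
                    + (F.scheme ℰp (γ / 1)).β K * minActionRegPr F J K hJK ε₀ U)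
                    = c + limUnder atTop (fun lam : ℝ => (Real.log (Node00.canonVersion (fieldMeasure (F.P J) 0 (Matrix.specialUnitaryGroup (Fin 2) ℂ))
                      (heightDensity F (γ / lam) hJK (histGood F ℰp (θBal F.L γ b₀ p₀) K J)) U)
                    + (F.scheme ℰp (γ / lam)).β K * minActionRegPr F J K hJK ε₀ U) - (Real.log (Node00.canonVersion (fieldMeasure (F.P J) 0 (Matrix.specialUnitaryGroup (Fin 2) ℂ))
                      (heightDensity F (γ / lam) hJK (histGood F ℰp (θBal F.L γ b₀ p₀) K J)) 1)
                    + (F.scheme ℰp (γ / lam)).β K * minActionRegPr F J K hJK ε₀ 1))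
                      + Real.log (polymerPartitionFunction polyInc (fun X : Finset (PBond (F.P J) 0) => ((w U X : ℝ) : ℂ)) Finset.univ).re := by
  intro L
  obtain ⟨c₀, hc₀, hc₀1, H⟩ := hE L
  refine ⟨c₀, hc₀, hc₀1, fun cw hcw hcwle => ?_⟩
  obtain ⟨pS, H0⟩ := H cw hcw hcwle
  refine ⟨pS, fun b₀ p₀ hb hp hp0 => ?_⟩
  obtain ⟨ε₁, hε₁, H1⟩ := H0 b₀ p₀ hb hp hp0
  refine ⟨ε₁, hε₁, fun ε₀ hε₀ hε₀le => ?_⟩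
  obtain ⟨γ₁, hγ₁, κ, hκ, H2⟩ := H1 ε₀ hε₀ hε₀le
  refine ⟨min γ₁ 1, lt_min hγ₁ one_pos, κ, hκ, fun F γ hFL hγ hγle => ?_⟩
  obtain ⟨Φ, hΦ0, hΦ, H3⟩ := H2 F γ hFL hγ (hγle.trans (min_le_left _ _))
  refine ⟨Φ, hΦ0, hΦ, fun J K hJK => ?_⟩
  obtain ⟨Cl, ell, w, hCl, hell, hgas, hprodZ, hlim⟩ := H3 J K hJK
  have hθ : 0 < θBal F.L γ (cw * b₀) p₀ J := by
    rw [T3InteriorExcision.θBal_mul]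
    exact mul_pos hcw (T3MinimiserStabilityReduction.θBal_pos (le_of_lt F.hL.2) hγ (hγle.trans (min_le_right _ _)) hb p₀ J)
  have h1 : PlaqSmall (θBal F.L γ (cw * b₀) p₀ J) (1 : GaugeField (F.P J) 0 (Matrix.specialUnitaryGroup (Fin 2) ℂ)) := T3DescentFibreTower.plaqSmall_one hθ
  have hsplit : ∀ lam : ℝ, 1 ≤ lam → ∀ U, U ∈ {U : GaugeField (F.P J) 0 (Matrix.specialUnitaryGroup (Fin 2) ℂ) | PlaqSmall (θBal F.L γ (cw * b₀) p₀ J) U} →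
      (fun (lam : ℝ) (U : GaugeField (F.P J) 0 (Matrix.specialUnitaryGroup (Fin 2) ℂ)) => (Real.log (Node00.canonVersion (fieldMeasure (F.P J) 0 (Matrix.specialUnitaryGroup (Fin 2) ℂ)) (heightDensity F (γ / lam) hJK (histGood F ℰp (θBal F.L γ b₀ p₀) K J)) U) + (F.scheme ℰp (γ / lam)).β K * minActionRegPr F J K hJK ε₀ U)) lam U
        = (fun lam : ℝ => Real.log (Cl lam)) lam + (fun U => Real.log (ell U)) U
          + (fun (lam : ℝ) (U : GaugeField (F.P J) 0 (Matrix.specialUnitaryGroup (Fin 2) ℂ)) =>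
              Real.log ((polymerPartitionFunction polyInc (fun X : Finset (PBond (F.P J) 0) => ((w lam U X : ℝ) : ℂ)) Finset.univ).re)) lam U :=
    fun lam hlam U hU => log_add_eq_of_mul_exp_eq (hCl lam hlam) (hell U hU) (hprodZ lam hlam U hU).1 (hprodZ lam hlam U hU).2
  refine ⟨Real.log (Cl 1) + Real.log (ell 1), w 1, hgas, fun U hU => ?_⟩
  exact eq_const_add_limUnder_add_of_split hsplit (fun U hU => hlim U hU) hU h1

open Classical in
/-- ★ **FULL WINDOW ⟹ INTERIOR WINDOW FOR THE PRODUCT-FORMULA LETTER**: px20's ⟨ECE⟩ (✓p783037's hypothesis text) gives ⟨ECE∘⟩ with `c₀ := 1`, `γ₁ ↦ min γ₁ 1` — the four window clauses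
restrict to the interior window. [cite: Balaban1985UV3, (7) p.257; Balaban1987RG1, (0.17)-(0.26) pp.255-257] -/
theorem productFormulaInt_of_productFormula
    (hE : ∀ (L : ℕ), ∃ pS : ℝ, ∀ (b₀ p₀ : ℝ), 0 < b₀ → pS ≤ p₀ → 0 < p₀ → ∃ ε₁ : ℝ, 0 < ε₁ ∧ ∀ (ε₀ : ℝ), 0 < ε₀ → ε₀ ≤ ε₁ →
      ∃ γ₁ : ℝ, 0 < γ₁ ∧ ∃ κ : ℝ, 0 < κ ∧
        ∀ (F : T3Family) (γ : ℝ), F.L = L → 0 < γ → γ ≤ γ₁ →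
          ∃ Φ : ℕ → ℝ, (∀ J, 0 ≤ Φ J) ∧ Tendsto (fun J : ℕ => (J : ℝ) * Φ J) atTop (𝓝 0) ∧
            ∀ (J K : ℕ) (hJK : J ≤ K),
              ∃ (Cl : ℝ → ℝ) (ell : GaugeField (F.P J) 0 (Matrix.specialUnitaryGroup (Fin 2) ℂ) → ℝ)
                (w : ℝ → GaugeField (F.P J) 0 (Matrix.specialUnitaryGroup (Fin 2) ℂ) → Finset (PBond (F.P J) 0) → ℝ),
              (∀ lam : ℝ, 1 ≤ lam → 0 < Cl lam) ∧
              (∀ U : GaugeField (F.P J) 0 (Matrix.specialUnitaryGroup (Fin 2) ℂ), PlaqSmall (θBal F.L γ b₀ p₀ J) U → 0 < ell U) ∧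
              (∃ (wbar a ℓ : Finset (PBond (F.P J) 0) → ℝ),
                (∀ U, w 1 U ∅ = 0) ∧
                (∀ (X : Finset (PBond (F.P J) 0)) (U U' : GaugeField (F.P J) 0 (Matrix.specialUnitaryGroup (Fin 2) ℂ)),
                  (∀ e ∈ X, U e = U' e) → w 1 U X = w 1 U' X) ∧
                (∀ X, 0 ≤ a X) ∧ (∀ X, 0 ≤ ℓ X) ∧
                (∀ U, U ∈ {U : GaugeField (F.P J) 0 (Matrix.specialUnitaryGroup (Fin 2) ℂ) | PlaqSmall (θBal F.L γ b₀ p₀ J) U} → ∀ X, |w 1 U X| ≤ wbar X) ∧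
                (∀ X : Finset (PBond (F.P J) 0), ∀ e ∈ X, ∀ e' ∈ X, (e.src.tdist e'.src : ℝ) ≤ ℓ X) ∧
                (∀ X : Finset (PBond (F.P J) 0), ∑ X' ∈ Finset.univ.filter (fun X' => polyInc X' X),
                    wbar X' * Real.exp (a X' + κ * ℓ X') ≤ a X) ∧
                (∀ e : PBond (F.P J) 0, a {e} ≤ (Φ J))) ∧
              (∀ lam : ℝ, 1 ≤ lam → ∀ U : GaugeField (F.P J) 0 (Matrix.specialUnitaryGroup (Fin 2) ℂ), PlaqSmall (θBal F.L γ b₀ p₀ J) U →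
                0 < (polymerPartitionFunction polyInc (fun X : Finset (PBond (F.P J) 0) => ((w lam U X : ℝ) : ℂ)) Finset.univ).re ∧
                Node00.canonVersion (fieldMeasure (F.P J) 0 (Matrix.specialUnitaryGroup (Fin 2) ℂ))
                    (heightDensity F (γ / lam) hJK (histGood F ℰp (θBal F.L γ b₀ p₀) K J)) U
                  * Real.exp ((F.scheme ℰp (γ / lam)).β K * minActionRegPr F J K hJK ε₀ U)
                = Cl lam * ell U * (polymerPartitionFunction polyInc (fun X : Finset (PBond (F.P J) 0) => ((w lam U X : ℝ) : ℂ)) Finset.univ).re) ∧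
              (∀ U : GaugeField (F.P J) 0 (Matrix.specialUnitaryGroup (Fin 2) ℂ), PlaqSmall (θBal F.L γ b₀ p₀ J) U →
                Tendsto (fun lam : ℝ => Real.log (polymerPartitionFunction polyInc (fun X : Finset (PBond (F.P J) 0) => ((w lam U X : ℝ) : ℂ)) Finset.univ).re) atTop (𝓝 0))) :
    ∀ (L : ℕ), ∃ c₀ : ℝ, 0 < c₀ ∧ c₀ ≤ 1 ∧ ∀ (cw : ℝ), 0 < cw → cw ≤ c₀ →
      ∃ pS : ℝ, ∀ (b₀ p₀ : ℝ), 0 < b₀ → pS ≤ p₀ → 0 < p₀ → ∃ ε₁ : ℝ, 0 < ε₁ ∧ ∀ (ε₀ : ℝ), 0 < ε₀ → ε₀ ≤ ε₁ →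
      ∃ γ₁ : ℝ, 0 < γ₁ ∧ ∃ κ : ℝ, 0 < κ ∧
        ∀ (F : T3Family) (γ : ℝ), F.L = L → 0 < γ → γ ≤ γ₁ →
          ∃ Φ : ℕ → ℝ, (∀ J, 0 ≤ Φ J) ∧ Tendsto (fun J : ℕ => (J : ℝ) * Φ J) atTop (𝓝 0) ∧
            ∀ (J K : ℕ) (hJK : J ≤ K),
              ∃ (Cl : ℝ → ℝ) (ell : GaugeField (F.P J) 0 (Matrix.specialUnitaryGroup (Fin 2) ℂ) → ℝ)
                (w : ℝ → GaugeField (F.P J) 0 (Matrix.specialUnitaryGroup (Fin 2) ℂ) → Finset (PBond (F.P J) 0) → ℝ),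
              (∀ lam : ℝ, 1 ≤ lam → 0 < Cl lam) ∧
              (∀ U : GaugeField (F.P J) 0 (Matrix.specialUnitaryGroup (Fin 2) ℂ), PlaqSmall (θBal F.L γ (cw * b₀) p₀ J) U → 0 < ell U) ∧
              (∃ (wbar a ℓ : Finset (PBond (F.P J) 0) → ℝ),
                (∀ U, w 1 U ∅ = 0) ∧
                (∀ (X : Finset (PBond (F.P J) 0)) (U U' : GaugeField (F.P J) 0 (Matrix.specialUnitaryGroup (Fin 2) ℂ)),
                  (∀ e ∈ X, U e = U' e) → w 1 U X = w 1 U' X) ∧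
                (∀ X, 0 ≤ a X) ∧ (∀ X, 0 ≤ ℓ X) ∧
                (∀ U, U ∈ {U : GaugeField (F.P J) 0 (Matrix.specialUnitaryGroup (Fin 2) ℂ) | PlaqSmall (θBal F.L γ (cw * b₀) p₀ J) U} → ∀ X, |w 1 U X| ≤ wbar X) ∧
                (∀ X : Finset (PBond (F.P J) 0), ∀ e ∈ X, ∀ e' ∈ X, (e.src.tdist e'.src : ℝ) ≤ ℓ X) ∧
                (∀ X : Finset (PBond (F.P J) 0), ∑ X' ∈ Finset.univ.filter (fun X' => polyInc X' X),
                    wbar X' * Real.exp (a X' + κ * ℓ X') ≤ a X) ∧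
                (∀ e : PBond (F.P J) 0, a {e} ≤ (Φ J))) ∧
              (∀ lam : ℝ, 1 ≤ lam → ∀ U : GaugeField (F.P J) 0 (Matrix.specialUnitaryGroup (Fin 2) ℂ), PlaqSmall (θBal F.L γ (cw * b₀) p₀ J) U →
                0 < (polymerPartitionFunction polyInc (fun X : Finset (PBond (F.P J) 0) => ((w lam U X : ℝ) : ℂ)) Finset.univ).re ∧
                Node00.canonVersion (fieldMeasure (F.P J) 0 (Matrix.specialUnitaryGroup (Fin 2) ℂ))
                    (heightDensity F (γ / lam) hJK (histGood F ℰp (θBal F.L γ b₀ p₀) K J)) U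
                  * Real.exp ((F.scheme ℰp (γ / lam)).β K * minActionRegPr F J K hJK ε₀ U)
                = Cl lam * ell U * (polymerPartitionFunction polyInc (fun X : Finset (PBond (F.P J) 0) => ((w lam U X : ℝ) : ℂ)) Finset.univ).re) ∧
              (∀ U : GaugeField (F.P J) 0 (Matrix.specialUnitaryGroup (Fin 2) ℂ), PlaqSmall (θBal F.L γ (cw * b₀) p₀ J) U →
                Tendsto (fun lam : ℝ => Real.log (polymerPartitionFunction polyInc (fun X : Finset (PBond (F.P J) 0) => ((w lam U X : ℝ) : ℂ)) Finset.univ).re) atTop (𝓝 0)) := by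
  intro L
  obtain ⟨pS, H⟩ := hE L
  refine ⟨1, one_pos, le_rfl, fun cw hcw hcw1 => ⟨pS, fun b₀ p₀ hb hp hp0 => ?_⟩⟩
  obtain ⟨ε₁, hε₁, H1⟩ := H b₀ p₀ hb hp hp0
  refine ⟨ε₁, hε₁, fun ε₀ hε₀ hε₀le => ?_⟩
  obtain ⟨γ₁, hγ₁, κ, hκ, H2⟩ := H1 ε₀ hε₀ hε₀le
  refine ⟨min γ₁ 1, lt_min hγ₁ one_pos, κ, hκ, fun F γ hFL hγ hγle => ?_⟩
  obtain ⟨Φ, hΦ0, hΦ, H3⟩ := H2 F γ hFL hγ (hγle.trans (min_le_left _ _))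
  refine ⟨Φ, hΦ0, hΦ, fun J K hJK => ?_⟩
  obtain ⟨Cl, ell, w, hCl, hell, ⟨wbar, a, ℓ, h0, hloc, ha, hℓ, hdom, hdiam, hKP, hpin⟩, hprodZ, hlim⟩ := H3 J K hJK
  have hθ : θBal F.L γ (cw * b₀) p₀ J ≤ θBal F.L γ b₀ p₀ J :=
    T3InteriorExcision.θBal_mul_le (le_of_lt F.hL.2) hγ (hγle.trans (min_le_right _ _)) hb hcw1 p₀ J
  have hsub : ∀ U : GaugeField (F.P J) 0 (Matrix.specialUnitaryGroup (Fin 2) ℂ), PlaqSmall (θBal F.L γ (cw * b₀) p₀ J) U → PlaqSmall (θBal F.L γ b₀ p₀ J) U :=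
    fun U hU => T3PrintedMinimiserExistence.plaqSmall_of_le hθ hU
  exact ⟨Cl, ell, w, hCl, fun U hU => hell U (hsub U hU), ⟨wbar, a, ℓ, h0, hloc, ha, hℓ, fun U hU => hdom U (hsub U hU), hdiam, hKP, hpin⟩,
    fun lam hlam U hU => hprodZ lam hlam U (hsub U hU), fun U hU => hlim U (hsub U hU)⟩

open Classical in
/-- ★★★ **⟨ECE∘⟩ → H4ᶜ∘ `BeyondOneLoopSmallIntCan` VERBATIM — THE INTERIOR PRODUCT FORMULA ALONE DELIVERS THE REGISTERED ROW 2** (SCL∘ by the split, GAS∘ by the identity at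
`λ = 1`, REP∘ by KPL, H4ᶜ∘ by ✓p786380).  Door-fit: `example (h : ⟨ECE∘⟩) : BeyondOneLoopSmallIntCan := beyondOneLoopSmallInt_of_productFormulaInt h`.
[cite: Balaban1987RG1, Thm 1 (0.19)-(0.26) pp.255-257; Balaban1985UV3, (45)-(47) p.267; Balaban1988Convergent, Thm 1] -/
theorem beyondOneLoopSmallInt_of_productFormulaInt
    (hE : ∀ (L : ℕ), ∃ c₀ : ℝ, 0 < c₀ ∧ c₀ ≤ 1 ∧ ∀ (cw : ℝ), 0 < cw → cw ≤ c₀ →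
      ∃ pS : ℝ, ∀ (b₀ p₀ : ℝ), 0 < b₀ → pS ≤ p₀ → 0 < p₀ → ∃ ε₁ : ℝ, 0 < ε₁ ∧ ∀ (ε₀ : ℝ), 0 < ε₀ → ε₀ ≤ ε₁ →
      ∃ γ₁ : ℝ, 0 < γ₁ ∧ ∃ κ : ℝ, 0 < κ ∧
        ∀ (F : T3Family) (γ : ℝ), F.L = L → 0 < γ → γ ≤ γ₁ →
          ∃ Φ : ℕ → ℝ, (∀ J, 0 ≤ Φ J) ∧ Tendsto (fun J : ℕ => (J : ℝ) * Φ J) atTop (𝓝 0) ∧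
            ∀ (J K : ℕ) (hJK : J ≤ K),
              ∃ (Cl : ℝ → ℝ) (ell : GaugeField (F.P J) 0 (Matrix.specialUnitaryGroup (Fin 2) ℂ) → ℝ)
                (w : ℝ → GaugeField (F.P J) 0 (Matrix.specialUnitaryGroup (Fin 2) ℂ) → Finset (PBond (F.P J) 0) → ℝ),
              (∀ lam : ℝ, 1 ≤ lam → 0 < Cl lam) ∧
              (∀ U : GaugeField (F.P J) 0 (Matrix.specialUnitaryGroup (Fin 2) ℂ), PlaqSmall (θBal F.L γ (cw * b₀) p₀ J) U → 0 < ell U) ∧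
              (∃ (wbar a ℓ : Finset (PBond (F.P J) 0) → ℝ),
                (∀ U, w 1 U ∅ = 0) ∧
                (∀ (X : Finset (PBond (F.P J) 0)) (U U' : GaugeField (F.P J) 0 (Matrix.specialUnitaryGroup (Fin 2) ℂ)),
                  (∀ e ∈ X, U e = U' e) → w 1 U X = w 1 U' X) ∧
                (∀ X, 0 ≤ a X) ∧ (∀ X, 0 ≤ ℓ X) ∧
                (∀ U, U ∈ {U : GaugeField (F.P J) 0 (Matrix.specialUnitaryGroup (Fin 2) ℂ) | PlaqSmall (θBal F.L γ (cw * b₀) p₀ J) U} → ∀ X, |w 1 U X| ≤ wbar X) ∧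
                (∀ X : Finset (PBond (F.P J) 0), ∀ e ∈ X, ∀ e' ∈ X, (e.src.tdist e'.src : ℝ) ≤ ℓ X) ∧
                (∀ X : Finset (PBond (F.P J) 0), ∑ X' ∈ Finset.univ.filter (fun X' => polyInc X' X),
                    wbar X' * Real.exp (a X' + κ * ℓ X') ≤ a X) ∧
                (∀ e : PBond (F.P J) 0, a {e} ≤ (Φ J))) ∧
              (∀ lam : ℝ, 1 ≤ lam → ∀ U : GaugeField (F.P J) 0 (Matrix.specialUnitaryGroup (Fin 2) ℂ), PlaqSmall (θBal F.L γ (cw * b₀) p₀ J) U →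
                0 < (polymerPartitionFunction polyInc (fun X : Finset (PBond (F.P J) 0) => ((w lam U X : ℝ) : ℂ)) Finset.univ).re ∧
                Node00.canonVersion (fieldMeasure (F.P J) 0 (Matrix.specialUnitaryGroup (Fin 2) ℂ))
                    (heightDensity F (γ / lam) hJK (histGood F ℰp (θBal F.L γ b₀ p₀) K J)) U
                  * Real.exp ((F.scheme ℰp (γ / lam)).β K * minActionRegPr F J K hJK ε₀ U)
                = Cl lam * ell U * (polymerPartitionFunction polyInc (fun X : Finset (PBond (F.P J) 0) => ((w lam U X : ℝ) : ℂ)) Finset.univ).re) ∧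
              (∀ U : GaugeField (F.P J) 0 (Matrix.specialUnitaryGroup (Fin 2) ℂ), PlaqSmall (θBal F.L γ (cw * b₀) p₀ J) U →
                Tendsto (fun lam : ℝ => Real.log (polymerPartitionFunction polyInc (fun X : Finset (PBond (F.P J) 0) => ((w lam U X : ℝ) : ℂ)) Finset.univ).re) atTop (𝓝 0))) :
    ∀ (L : ℕ), ∃ c₀ : ℝ, 0 < c₀ ∧ c₀ ≤ 1 ∧ ∀ (c : ℝ), 0 < c → c ≤ c₀ → ∃ pS : ℝ, ∀ (b₀ p₀ : ℝ), 0 < b₀ → pS ≤ p₀ → 0 < p₀ →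
      ∃ ε₁ : ℝ, 0 < ε₁ ∧ ∀ (ε₀ : ℝ), 0 < ε₀ → ε₀ ≤ ε₁ →
      ∃ γ₁ : ℝ, 0 < γ₁ ∧ ∃ κ : ℝ, 0 < κ ∧ ∀ (F : T3Family) (γ : ℝ), F.L = L → 0 < γ → γ ≤ γ₁ →
        ∃ φ₂ : ℕ → ℝ, (∀ J, 0 ≤ φ₂ J) ∧ Tendsto (fun J : ℕ => (J : ℝ) * φ₂ J) atTop (𝓝 0) ∧
          ∀ (J K : ℕ) (hJK : J ≤ K) (b b' : PBond (F.P J) 0) (U V W Z : GaugeField (F.P J) 0 (Matrix.specialUnitaryGroup (Fin 2) ℂ)),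
            PlaqSmall (θBal F.L γ (c * b₀) p₀ J) U → PlaqSmall (θBal F.L γ (c * b₀) p₀ J) V →
            PlaqSmall (θBal F.L γ (c * b₀) p₀ J) W → PlaqSmall (θBal F.L γ (c * b₀) p₀ J) Z →
            (∀ e, e ≠ b → U e = V e) → (∀ e, e ≠ b' → U e = W e) → (∀ e, e ≠ b' → V e = Z e) → (∀ e, e ≠ b → W e = Z e) →
            |(((Real.log (Node00.canonVersion (fieldMeasure (F.P J) 0 (Matrix.specialUnitaryGroup (Fin 2) ℂ)) (heightDensity F (γ / 1) hJK (histGood F ℰp (θBal F.L γ b₀ p₀) K J)) U) + (F.scheme ℰp (γ / 1)).β K * minActionRegPr F J K hJK ε₀ U)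
                - (Real.log (Node00.canonVersion (fieldMeasure (F.P J) 0 (Matrix.specialUnitaryGroup (Fin 2) ℂ)) (heightDensity F (γ / 1) hJK (histGood F ℰp (θBal F.L γ b₀ p₀) K J)) V) + (F.scheme ℰp (γ / 1)).β K * minActionRegPr F J K hJK ε₀ V))
              - ((Real.log (Node00.canonVersion (fieldMeasure (F.P J) 0 (Matrix.specialUnitaryGroup (Fin 2) ℂ)) (heightDensity F (γ / 1) hJK (histGood F ℰp (θBal F.L γ b₀ p₀) K J)) W) + (F.scheme ℰp (γ / 1)).β K * minActionRegPr F J K hJK ε₀ W)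
                - (Real.log (Node00.canonVersion (fieldMeasure (F.P J) 0 (Matrix.specialUnitaryGroup (Fin 2) ℂ)) (heightDensity F (γ / 1) hJK (histGood F ℰp (θBal F.L γ b₀ p₀) K J)) Z) + (F.scheme ℰp (γ / 1)).β K * minActionRegPr F J K hJK ε₀ Z)))
              - limUnder atTop (fun lam : ℝ =>
                ((Real.log (Node00.canonVersion (fieldMeasure (F.P J) 0 (Matrix.specialUnitaryGroup (Fin 2) ℂ)) (heightDensity F (γ / lam) hJK (histGood F ℰp (θBal F.L γ b₀ p₀) K J)) U) + (F.scheme ℰp (γ / lam)).β K * minActionRegPr F J K hJK ε₀ U)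
                  - (Real.log (Node00.canonVersion (fieldMeasure (F.P J) 0 (Matrix.specialUnitaryGroup (Fin 2) ℂ)) (heightDensity F (γ / lam) hJK (histGood F ℰp (θBal F.L γ b₀ p₀) K J)) V) + (F.scheme ℰp (γ / lam)).β K * minActionRegPr F J K hJK ε₀ V))
                - ((Real.log (Node00.canonVersion (fieldMeasure (F.P J) 0 (Matrix.specialUnitaryGroup (Fin 2) ℂ)) (heightDensity F (γ / lam) hJK (histGood F ℰp (θBal F.L γ b₀ p₀) K J)) W) + (F.scheme ℰp (γ / lam)).β K * minActionRegPr F J K hJK ε₀ W)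
                  - (Real.log (Node00.canonVersion (fieldMeasure (F.P J) 0 (Matrix.specialUnitaryGroup (Fin 2) ℂ)) (heightDensity F (γ / lam) hJK (histGood F ℰp (θBal F.L γ b₀ p₀) K J)) Z) + (F.scheme ℰp (γ / lam)).β K * minActionRegPr F J K hJK ε₀ Z)))|
              ≤ φ₂ J * Real.exp (-(κ * (b.src.tdist b'.src : ℝ))) :=
  beyondOneLoopSmallInt_of_gasInt (sclInt_of_productFormulaInt hE) (gasInt_of_productFormulaInt hE)

end Summit.QuantumFields.YangMills.Theorems.BeyondOneLoopInteriorProductDoor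

end
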